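/-
Copyright (c) 2026. All rights reserved.
Released under Apache 2.0 license as described in the file LICENSE.
Authors: abc-iut cell, seat abc-iut-L4-t10 (gen 3; node `AbsTopIII:Cor4.5`, the one free hypothesis of
the archimedean MODEL `cor_4_5_arch` discharged by the printed route at the Galois-category instance).
-/
import Literature.AnabelianGeometry.AbsoluteAnabelian.AbsTopIII.AutHolLogFrobeniusModelProofs
import Literature.AnabelianGeometry.AbsoluteAnabelian.SubpadicExamples
import Literature.AnabelianGeometry.AbsoluteAnabelian.SubpadicSlimProofs
import Literature.AnabelianGeometry.Anabelioids.Induction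
import Literature.NumberTheory.GaloisRepresentations.AbsGaloisGroupCompact
import Mathlib.CategoryTheory.Category.ULift
import HarnessLib

/-!
# [AbsTopIII] Cor 4.5 at the archimedean model: id-rigidity of `EA` FROM SLIMNESS (Galois-category instance)

S. Mochizuki, *Topics in absolute anabelian geometry III*, §4: Cor 4.5 (i)–(v) pp. 107–110, Prop 4.2 (i)
and its proof pp. 105–106, Lemma 4.3 p. 106, Def 4.1 (i)/(iii) pp. 101–103 of the author's kurims
manuscript (lit key `paper:url-5493eb38cbb7`, read on the page; bib key `MochizukiAbsTopIII2015`).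
Companion (model constructions + proofs; no new notion) of `AbsTopIII/AutHolLogFrobeniusModelProofs.lean` (abc-iut cell, node
`AbsTopIII:Cor4.5`, sub-DAG row C45-M0 of plan/L4/SUBDAG-AbsTopIII-Cor45.md; seat abc-iut-L4-t10).

The capstone there, `AbsTopIII.cor_4_5_arch 𝔄 X₀ hE`, gives Cor 4.5 (i)–(v) AS TYPED for the archimedean
model `archLogFrobeniusData 𝔄` over the Cor 2.7 (e)+functoriality interface `𝔄 : AutHolFieldFunctor`
from exactly two inputs: an object `X₀` of `EA` and `hE : IsIdRigid 𝔄.EA`.  In print the second input is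
discharged by ONE sentence of the proof of Prop 4.2 (i) (p. 106 l. 18–19): "Thus, the id-rigidity of `EA`
follows immediately from the slimness assertion of Lemma 4.3" — `EA` being "the subcategor[y of `TH`]
determined … by the elliptically admissible hyperbolic orbicurves over CAF's and the finite étale
morphisms" (Def 4.1 (iii) p. 103), i.e., over a fixed core, [the connected objects of] the Galois
category `B(Π)` of finite étale coverings, `Π` the (slim, Lemma 4.3) arithmetic fundamental group.

This file makes that sentence literal at the **Galois-category instance** of the interface:

* `AutHolFieldFunctor.ofConstField E` — the interface datum on an arbitrary category `E` with
  `𝒜_𝕏 := ℂ` for every `𝕏` and `𝒜_φ := id` for every `φ` (Cor 2.7 (e): `𝒜_p ∪ {0}` is a CAF, here `ℂ`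
  itself; that the isomorphism induced by a finite étale = holomorphic morphism is the IDENTITY on
  multipliers is abc-iut-w4-d104's kernel fact `hasDerivAt_conj_mulAffine` at the germ model,
  `HolomorphicCoresGermConjugation.lean`, GAP-LEDGER row D-G-w5d226-1);
* `AutHolFieldFunctor.ofGaloisCategory Π` — the case `E := B(Π)` ([FrdI] §0 `BCat Π` = Mathlib
  `ContAction FintypeCat Π`, with its hom-types lifted to the interface's universe by `ULiftHom`);
* `AutHolFieldFunctor.isIdRigid_EA_ofGaloisCategory` — **`EA = B(Π)` is id-rigid as soon as `Π` is
  slim**: abc-iut-w5-d215's `isIdRigid_bCat_of_isSlimGroup` ([SemiAnbd] §0 "`B(G)` slim iff `G` slim",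
  landed by abc-iut-L3, + "slim ⇒ id-rigid") transported along `ULiftHom` (`isIdRigid_uLiftHom`:
  id-rigidity does not see the universe of the hom-types);
* `AbsTopIII.cor_4_5_arch_ofGaloisCategory (hG : IsSlimGroup Π) (X₀ : BCat Π)` — **Cor 4.5 (i)–(v) for
  the archimedean model at this instance, from the slimness of `Π` and one finite étale covering only**;
* `AbsTopIII.cor_4_5_arch_absoluteGaloisGroup_padic p` — an UNCONDITIONAL instance: for
  `Π := G_{ℚ_p}` (slim: abc-iut-L4-d2's PROVED [pGC] Lemma 15.8,
  `IsSubpadicFor.isSlimGroup_absoluteGaloisGroup`) and `X₀ := G_{ℚ_p}/G_{ℚ_p}` (the core itself,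
  abc-iut-L3's `Induction.quotObj`), Cor 4.5 (i)–(v) as typed hold outright — an `EA` with non-trivial
  automorphism groups that is id-rigid BY SLIMNESS, upgrading the consistency witness
  `cor_4_5_arch_hypotheses_satisfiable` (`EA = Discrete PUnit`) of the companion file.

Honest scope.  A MODEL instance: the interface is fed a Galois category and the constant CAF `ℂ`; the
GEOMETRIC instance (the Cor 2.7 algorithms on elliptically admissible Aut-holomorphic orbispaces,
GAP-LEDGER row G-w5d226-1) is not constructed here, and the slim profinite group of the unconditional
example is a `p`-adic absolute Galois group, not a profinite surface group (whose slimness, [Mzk20]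
Prop 2.3 (i), is FACT-policy in the cell).  Refereed pre-IUT anabelian geometry; nothing here bears on
[IUTchIII] Cor. 3.12 or takes a side; typed ≠ discharged.
-/

set_option autoImplicit false

noncomputable section

namespace Literature.AnabelianGeometry.AbsoluteAnabelian

open _root_.CategoryTheory
open Literature.AlgebraicGeometry.Frobenioids (BCat IsSlimGroup)


/-! ### The interface datum with constant field `ℂ` on an arbitrary category -/

namespace AutHolFieldFunctor

/-- **The Cor 2.7 (e)+functoriality datum with constant field** on a category `E`: `EA := E`,
`𝒜_𝕏 := ℂ` ("`𝒜_p ∪ {0}` … [a CAF]", Def 4.1 (i)), and `𝒜_φ := id` for every morphism `φ` (at the germ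
model the isomorphism induced along a holomorphic local isomorphism is the identity on multipliers).
[cite: MochizukiAbsTopIII2015, Definition 4.1 (i) p.101] -/
def ofConstField (E : Type 1) [Category.{1} E] : AutHolFieldFunctor.{0} where
  EA := E
  A := fun _ => ℂ
  isCAF := fun _ => isCAF_complex
  Amap := fun _ => RingEquiv.refl ℂ
  continuous_Amap := fun _ => continuous_id
  continuous_Amap_symm := fun _ => continuous_id
  Amap_id := fun _ => rfl
  Amap_comp := fun _ _ => rfl

/-- The objects of `EA` for the constant-field datum are the objects of `E`.
[cite: MochizukiAbsTopIII2015, Definition 4.1 (i) p.101] -/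
theorem ofConstField_EA (E : Type 1) [Category.{1} E] : (ofConstField E).EA = E := rfl

/-- `𝒜_φ` is the identity for the constant-field datum.
[cite: MochizukiAbsTopIII2015, Definition 4.1 (i) p.101] -/
@[simp] theorem ofConstField_Amap_apply {E : Type 1} [Category.{1} E] {X Y : E} (f : X ⟶ Y)
    (a : (ofConstField E).A X) : (ofConstField E).Amap f a = a := rfl

/-- If `E` is id-rigid then so is the `EA` of the constant-field datum on `E` (they are the same
category). [cite: MochizukiAbsTopIII2015, Proposition 4.2 (i) p.105] -/
theorem isIdRigid_EA_ofConstField {E : Type 1} [Category.{1} E] (hE : IsIdRigid E) :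
    IsIdRigid (ofConstField E).EA := hE

end AutHolFieldFunctor

/-! ### Id-rigidity is insensitive to lifting the universe of the hom-types -/

section ULiftHom

universe w v u

variable {C : Type u} [Category.{v} C]

/-- An automorphism of the identity functor of `ULiftHom C` has, after `ULift.down`, the components
of an automorphism of the identity functor of `C`. [cite: MochizukiAbsTopIII2015, Section 0 p.27] -/
def idIsoDown (α : 𝟭 (ULiftHom.{w} C) ≅ 𝟭 (ULiftHom.{w} C)) : 𝟭 C ≅ 𝟭 C :=
  NatIso.ofComponents
    (fun y =>
      { hom := (α.hom.app (ULiftHom.objUp y)).down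
        inv := (α.inv.app (ULiftHom.objUp y)).down
        hom_inv_id := congrArg ULift.down (α.hom_inv_id_app (ULiftHom.objUp y))
        inv_hom_id := congrArg ULift.down (α.inv_hom_id_app (ULiftHom.objUp y)) })
    (fun {y y'} f =>
      congrArg ULift.down (α.hom.naturality (X := ULiftHom.objUp y) (Y := ULiftHom.objUp y') ⟨f⟩))

/-- The components of `idIsoDown α` are the `down`s of the components of `α`.
[cite: MochizukiAbsTopIII2015, Section 0 p.27] -/
theorem idIsoDown_hom_app (α : 𝟭 (ULiftHom.{w} C) ≅ 𝟭 (ULiftHom.{w} C)) (y : C) :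
    (idIsoDown α).hom.app y = (α.hom.app (ULiftHom.objUp y)).down := rfl

/-- **Id-rigidity is invariant under `ULiftHom`** (lifting the universe of the hom-types of a category
changes nothing about automorphisms of its identity functor). [cite: MochizukiAbsTopIII2015, Section 0 p.27] -/
theorem isIdRigid_uLiftHom (hC : IsIdRigid C) : IsIdRigid (ULiftHom.{w} C) := by
  refine isRigidFunctor_of_hom_app_eq_id fun α x => ?_
  have hβ : idIsoDown α = Iso.refl _ := hC (idIsoDown α)
  have hx : (idIsoDown α).hom.app x.objDown = 𝟙 x.objDown := by
    rw [hβ]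
    rfl
  rw [idIsoDown_hom_app] at hx
  apply ULift.ext
  exact hx

end ULiftHom

/-! ### The Galois-category instance `EA := B(Π)` -/

section Galois

variable (G : Type) [Group G] [TopologicalSpace G]

namespace AutHolFieldFunctor

/-- **The Galois-category instance of the Cor 2.7 (e)+functoriality interface**: `EA := B(Π)`, the
category of finite sets with continuous `Π`-action ("the subcategor[y] determined … by the elliptically
admissible hyperbolic orbicurves over CAF's and the finite étale morphisms" over a fixed core with
arithmetic fundamental group `Π`, read as the Galois category of finite étale coverings; hom-types
lifted by `ULiftHom`), `𝒜_𝕏 := ℂ`, `𝒜_φ := id`.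
[cite: MochizukiAbsTopIII2015, Definition 4.1 (iii) p.103] -/
def ofGaloisCategory : AutHolFieldFunctor.{0} :=
  ofConstField (ULiftHom.{1} (BCat G))

/-- The objects of `EA` at the Galois-category instance are the finite continuous `Π`-sets.
[cite: MochizukiAbsTopIII2015, Definition 4.1 (iii) p.103] -/
theorem ofGaloisCategory_EA : (ofGaloisCategory G).EA = ULiftHom.{1} (BCat G) := rfl

/-- A finite continuous `Π`-set as an object of `EA` at the Galois-category instance.
[cite: MochizukiAbsTopIII2015, Definition 4.1 (iii) p.103] -/
def objOfBCat (X : BCat G) : (ofGaloisCategory G).EA :=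
  show ULiftHom.{1} (BCat G) from ULiftHom.objUp X

variable {G} in
/-- **"The id-rigidity of `EA` follows immediately from the slimness assertion of Lemma 4.3"**
(proof of Prop 4.2 (i), p. 106 l. 18–19), at the Galois-category instance: if every open subgroup of
the profinite group `Π` has trivial centraliser, then `EA = B(Π)` is id-rigid — [SemiAnbd] §0
("`B(G)` slim iff `G` slim") and [FrdI]/[AbsTopIII] §0 ("slim ⇒ id-rigid"), i.e.
`isIdRigid_bCat_of_isSlimGroup`, transported along `B(Π) ≌ ULiftHom (B(Π))` (`isIdRigid_uLiftHom`).
[cite: MochizukiAbsTopIII2015, Proposition 4.2 (i) p.106] -/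
theorem isIdRigid_EA_ofGaloisCategory [IsTopologicalGroup G] [CompactSpace G] [T2Space G]
    [TotallyDisconnectedSpace G] (hG : IsSlimGroup G) : IsIdRigid (ofGaloisCategory G).EA :=
  isIdRigid_uLiftHom (isIdRigid_bCat_of_isSlimGroup G hG)

end AutHolFieldFunctor

namespace AbsTopIII

variable {G} in
/-- **[AbsTopIII] Corollary 4.5 (i)–(v) for the archimedean model at the Galois-category instance,
from slimness**: for a slim profinite group `Π` (Lemma 4.3: "the étale fundamental group `Π_X` of `X` is
slim") and one finite continuous `Π`-set `X₀` (one finite étale covering), Cor 4.5 as typed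
(`Cor_4_5 = LogFrobeniusCompatible`) holds for `archLogFrobeniusData (ofGaloisCategory Π)` with its
first-row telecore data — `cor_4_5_arch` with its id-rigidity input DISCHARGED by
`isIdRigid_EA_ofGaloisCategory`. [cite: MochizukiAbsTopIII2015, Corollary 4.5 pp.107–109] -/
theorem cor_4_5_arch_ofGaloisCategory [IsTopologicalGroup G] [CompactSpace G] [T2Space G]
    [TotallyDisconnectedSpace G] (hG : IsSlimGroup G) (X₀ : BCat G) :
    Literature.AnabelianGeometry.AbsoluteAnabelian.AbsTopIII.Cor_4_5
      (archLogFrobeniusData (AutHolFieldFunctor.ofGaloisCategory G))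
      (archTelecoreData (AutHolFieldFunctor.ofGaloisCategory G)) :=
  cor_4_5_arch (AutHolFieldFunctor.ofGaloisCategory G) (AutHolFieldFunctor.objOfBCat G X₀)
    (AutHolFieldFunctor.isIdRigid_EA_ofGaloisCategory hG)

variable {G} in
/-- The five printed items separately, at the Galois-category instance, from slimness.
[cite: MochizukiAbsTopIII2015, Corollary 4.5 pp.107–109] -/
theorem cor_4_5_arch_ofGaloisCategory_items [IsTopologicalGroup G] [CompactSpace G] [T2Space G]
    [TotallyDisconnectedSpace G] (hG : IsSlimGroup G) (X₀ : BCat G) :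
    Cor_4_5_i (archLogFrobeniusData (AutHolFieldFunctor.ofGaloisCategory G)) ∧
      Cor_4_5_ii (archLogFrobeniusData (AutHolFieldFunctor.ofGaloisCategory G))
        (archTelecoreData (AutHolFieldFunctor.ofGaloisCategory G)) ∧
      Cor_4_5_iii (archLogFrobeniusData (AutHolFieldFunctor.ofGaloisCategory G)) ∧
      Cor_4_5_iv (archLogFrobeniusData (AutHolFieldFunctor.ofGaloisCategory G))
        (archTelecoreData (AutHolFieldFunctor.ofGaloisCategory G)) ∧
      Cor_4_5_v (archLogFrobeniusData (AutHolFieldFunctor.ofGaloisCategory G)) :=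
  (cor_4_5_iff _ _).mp (cor_4_5_arch_ofGaloisCategory hG X₀)

end AbsTopIII

end Galois

/-! ### An unconditional instance: `Π := G_{ℚ_p}` -/

namespace AbsTopIII

open Literature.AnabelianGeometry.Anabelioids (Induction.quotObj)

variable (p : ℕ) [Fact p.Prime]

/-- `G_{ℚ_p} = Gal(ℚ̄_p/ℚ_p)` with its Krull topology is a profinite group all of whose open subgroups
have trivial centraliser ([pGC] Lemma 15.8 for the sub-`p`-adic field `ℚ_p`, PROVED in the tree).
[cite: MochizukiAbsTopIII2015, Lemma 4.3 p.106] -/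
theorem isSlimGroup_absoluteGaloisGroup_padic : IsSlimGroup (Field.absoluteGaloisGroup ℚ_[p]) :=
  IsSubpadicFor.isSlimGroup_absoluteGaloisGroup (IsSubpadicFor.padic p)

/-- **Cor 4.5 (i)–(v) as typed hold OUTRIGHT at the Galois-category instance `Π := G_{ℚ_p}`** of the
archimedean model (object: the one-point `Π`-set `Π/Π`, "the core itself"): an instance of the
interface whose `EA` has non-trivial automorphism groups and is id-rigid by slimness — a consistency
witness for the whole typed chain Cor 4.5 ⟸ {Lemma 4.4, Prop 4.2 (i) ⟸ Lemma 4.3}; the geometric `EA`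
of Cor 2.7 is not constructed. [cite: MochizukiAbsTopIII2015, Corollary 4.5 pp.107–109] -/
theorem cor_4_5_arch_absoluteGaloisGroup_padic :
    Literature.AnabelianGeometry.AbsoluteAnabelian.AbsTopIII.Cor_4_5
      (archLogFrobeniusData (AutHolFieldFunctor.ofGaloisCategory (Field.absoluteGaloisGroup ℚ_[p])))
      (archTelecoreData (AutHolFieldFunctor.ofGaloisCategory (Field.absoluteGaloisGroup ℚ_[p]))) := by
  haveI : CompactSpace (Field.absoluteGaloisGroup ℚ_[p]) :=
    Literature.NumberTheory.GaloisRepresentations.absoluteGaloisGroup_compactSpace ℚ_[p]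
  haveI : Subsingleton (Field.absoluteGaloisGroup ℚ_[p] ⧸ (⊤ : Subgroup (Field.absoluteGaloisGroup ℚ_[p]))) :=
    QuotientGroup.subsingleton_quotient_top
  haveI : Finite (Field.absoluteGaloisGroup ℚ_[p] ⧸ (⊤ : Subgroup (Field.absoluteGaloisGroup ℚ_[p]))) :=
    Finite.of_subsingleton
  exact cor_4_5_arch_ofGaloisCategory (isSlimGroup_absoluteGaloisGroup_padic p)
    (Induction.quotObj (⊤ : Subgroup (Field.absoluteGaloisGroup ℚ_[p])) isOpen_univ)

end AbsTopIII

end Literature.AnabelianGeometry.AbsoluteAnabelian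

end
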